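import Summits.CriticalPhenomena.SAWScalingLimit.Theorems.SAWWeldingIdentificationWeldingLawOfLimitLatticeSandwich
import Literature.Probability.RandomPlanarGeometry.SLEConvergenceCriterion

/-!
# Chord proxies exist under tightness and simplicity (crux `WeldingLawOfLimit`, stmt-4502)

Route `SAWWeldingIdentification` of `CriticalPhenomena/SAWScalingLimit`, crux (W)
`WeldingLawOfLimit` (stmt-CriticalPhenomena-4502), line `registered`. The companion files
`…WeldingLawOfLimitLattice.lean` / `…LatticeSandwich.lean` reduce the held stub 2a to its LATTICE
form (chord proxies of the walk whose canonical-welding marginals converge to SLE_{8/3}'s) and show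
`SAWScalingLimit ⟺ lattice welding law` modulo stmt-4982 (`SimpleSubseqLimits`), stmt-1372
(`EventualTight`) and the EXISTENCE of chord proxies close to the walk in probability. This file
discharges the last input from the first two:

* `tendsto_measure_curve_mem_of_isClosed` — under `EventualTight` and `SimpleSubseqLimits`, along
  every `δₙ → 0⁺` the critical SAW laws give vanishing mass to every CLOSED set of curve classes
  containing no simple chord of `(Ω; a, b) = Q.chord 0 2` (subsequence principle; Prokhorov along
  the mesh for the surrogate probability laws, `IsTightAlongMesh.exists_subseq`; the subsequential
  limit is chord-supported by stmt-4982; portmanteau for closed sets,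
  `ProbabilityMeasure.limsup_measure_closed_le_of_tendsto`);
* `nonempty_isSimpleChord_of_eventualTight_of_simpleSubseqLimits` — hence simple chords exist
  (else all mass would vanish, while the laws are eventually probability measures);
* `chordProxies_of_eventualTight_of_simpleSubseqLimits` — **chord proxies**: `cₙ ω :=` a simple
  chord at distance `< infDist (ω.curve) {chords} + δₙ` from the walk; these are simple chords for
  every `n, ω`, and `P_δₙ {ε < dist ω.curve (cₙ ω)} ≤ P_δₙ {ε/2 ≤ infDist ω.curve {chords}} → 0`
  by the first lemma applied to the closed set `{γ | ε/2 ≤ infDist γ {chords}}`;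
* `sawScalingLimit_iff_latticeWeldingLaw_of_eventualTight` — so, modulo stmt-4982 and stmt-1372
  alone, `SAWScalingLimit ⟺ lattice welding law`, and (`approxWeldingLaw_iff_latticeWeldingLaw`)
  the held stub 2a `ApproxWeldingLaw` ⟺ its lattice form.

No new definition, no named fact.

References: Billingsley, *Convergence of probability measures* (2nd ed., 1999), Thm 2.1
(portmanteau), Thm 5.1 (Prokhorov); Aizenman–Burchard, Duke Math. J. 99 (1999) §2.
-/

noncomputable section

open MeasureTheory Filter Topology Set
open scoped NNReal ENNReal BoundedContinuousFunction
open Literature.Probability.RandomPlanarGeometry Literature.Probability.LatticeModels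
open Literature.Probability.Process (preWienerMeasure)
open Summit.CriticalPhenomena.SAWScalingLimit.Theses

namespace Summit.CriticalPhenomena.SAWScalingLimit.Theorems.WeldingLawOfLimit

/-! ### Vanishing mass on closed sets without chords -/

/-- **Closed sets containing no simple chord get vanishing SAW mass.** Assume eventual tightness of
the pushed-forward critical SAW laws (stmt-1372 `EventualTight`) and simplicity of subsequential
limits (stmt-4982 `SimpleSubseqLimits`). Then for every conformal rectangle `Q`, endpoint
approximation of `(Ω; a, b) = Q.chord 0 2`, positive `δₙ → 0` and closed `F ⊆ CurveClass ℂ`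
containing no simple chord of `(Ω; a, b)`, `P_δₙ {ω.curve ∈ F} → 0`. Proof: by the subsequence
principle it suffices to find, inside every subsequence, a further one along which the masses tend
to `0`; Prokhorov along the mesh (`IsTightAlongMesh.exists_subseq`, run on the surrogate family of
probability laws, equal to the pushed-forward SAW laws for small `δ`) gives a weakly convergent
further subsequence with a probability limit `P'`, which is chord-supported (stmt-4982), so
`P' F = 0`, and the portmanteau inequality for closed sets bounds the `limsup` of the masses by
`P' F`. Billingsley (1999) Thms 2.1, 5.1. [folklore] -/
theorem tendsto_measure_curve_mem_of_isClosed (hT : SAWWeldingIdentification.EventualTight)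
    (h1 : SAWLoopFugacityFlow.SimpleSubseqLimits) (Q : ConformalRectangle) (a b : ℝ → Site 2)
    (hab : SAW.IsEndpointApprox (Q.chord 0 2 (by decide)) a b)
    (δs : ℕ → ℝ) (hpos : ∀ n, 0 < δs n) (hδ : Tendsto δs atTop (𝓝 0))
    {F : Set (CurveClass ℂ)} (hFc : IsClosed F)
    (hF : ∀ γ ∈ F, ¬ (Q.chord 0 2 (by decide)).IsSimpleChord γ) :
    Tendsto (fun n => SAW.law Q.carrier (δs n) (a (δs n)) (b (δs n))
      {ω | ω.curve ∈ F}) atTop (𝓝 0) := by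
  classical
  -- laws, curve observable, eventual probability
  have hYm : ∀ δ, AEMeasurable (fun γ : SAW.DomainSAW Q.carrier δ (a δ) (b δ) => γ.curve)
      (SAW.law Q.carrier δ (a δ) (b δ)) := fun δ => SAW.aemeasurable_curve _ _ _ _
  -- (stated over `Q.carrier`; the instance is rebuilt from its `measure_univ` field, which avoids
  -- an expensive definitional unfolding of `(Q.chord 0 2).carrier` inside the class argument)
  have hP : ∀ᶠ δ in 𝓝[>] (0 : ℝ), IsProbabilityMeasure (SAW.law Q.carrier δ (a δ) (b δ)) :=
    (SubseqIdentification.Negative.eventually_isProbabilityMeasure_law hab).mono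
      fun δ h => ⟨h.measure_univ⟩
  -- (1) surrogate family of probability laws on the curve space
  obtain ⟨ν, hν⟩ : ∃ ν : ℝ → Measure (CurveClass ℂ), ∀ δ, ν δ =
      if IsProbabilityMeasure ((SAW.law Q.carrier δ (a δ) (b δ)).map fun γ => γ.curve) then
        (SAW.law Q.carrier δ (a δ) (b δ)).map fun γ => γ.curve
      else Measure.dirac (CurveClass.mk (Curve.const 0)) :=
    ⟨_, fun _ => rfl⟩
  haveI hνprob : ∀ δ, IsProbabilityMeasure (ν δ) := by
    intro δ
    by_cases h : IsProbabilityMeasure ((SAW.law Q.carrier δ (a δ) (b δ)).map fun γ => γ.curve)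
    · rw [hν δ, if_pos h]
      exact h
    · rw [hν δ, if_neg h]
      infer_instance
  -- (2) for all small `δ > 0` the surrogate IS the pushed-forward law
  have hev : ∀ᶠ δ in 𝓝[>] (0 : ℝ),
      ν δ = (SAW.law Q.carrier δ (a δ) (b δ)).map fun γ => γ.curve := by
    filter_upwards [hP] with δ hPδ
    haveI := hPδ
    rw [hν δ, if_pos (Measure.isProbabilityMeasure_map (hYm δ))]
  -- (3) tightness along the mesh, for the laws and for the surrogates
  obtain ⟨δ₀, hδ₀, hTset⟩ := hT (Q.chord 0 2 (by decide)) a b hab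
  have hTm : IsTightAlongMesh (fun δ (γ : SAW.DomainSAW Q.carrier δ (a δ) (b δ)) => γ.curve)
      (fun δ => SAW.law Q.carrier δ (a δ) (b δ)) :=
    isTightAlongMesh_of_isTightMeasureSet_image (Eventually.of_forall hYm) hδ₀ hTset
  have hTν : IsTightAlongMesh (Ωδ := fun _ : ℝ => CurveClass ℂ)
      (fun (_ : ℝ) (x : CurveClass ℂ) => x) ν := by
    intro ε hε
    obtain ⟨K, hK, hb⟩ := hTm ε hε
    refine ⟨K, hK, ?_⟩
    filter_upwards [hb, hev] with δ hδK hδν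
    have hpre : (fun x : CurveClass ℂ => x) ⁻¹' Kᶜ = Kᶜ := rfl
    rw [hpre, hδν, Measure.map_apply_of_aemeasurable (hYm δ) hK.isClosed.isOpen_compl.measurableSet]
    exact hδK
  -- (4) subsequence principle
  refine tendsto_of_subseq_tendsto fun ns hns => ?_
  have hs : Tendsto (fun m => δs (ns m)) atTop (𝓝[>] (0 : ℝ)) :=
    (tendsto_nhdsWithin_Ioi_of_pos hpos hδ).comp hns
  obtain ⟨N, hN⟩ := eventually_atTop.1 (hs.eventually hev)
  have hs' : Tendsto (fun m => δs (ns (m + N))) atTop (𝓝[>] (0 : ℝ)) :=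
    hs.comp (tendsto_add_atTop_nat N)
  have hN' : ∀ m, ν (δs (ns (m + N))) =
      (SAW.law Q.carrier (δs (ns (m + N))) (a (δs (ns (m + N)))) (b (δs (ns (m + N))))).map
        fun γ => γ.curve := fun m => hN _ (N.le_add_left m)
  -- Prokhorov for the surrogates along the shifted subsequence
  obtain ⟨φ, P', hφ, hP', hlim⟩ := hTν.exists_subseq
    (Eventually.of_forall fun _ => aemeasurable_id') hs'
  haveI := hP'
  have hint : ∀ (g : CurveClass ℂ →ᵇ ℝ) (m : ℕ), ∫ x, g x ∂ν (δs (ns (φ m + N))) =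
      ∫ ω, g ω.curve ∂(SAW.law Q.carrier (δs (ns (φ m + N))) (a (δs (ns (φ m + N))))
        (b (δs (ns (φ m + N))))) := fun g m => by
    rw [hN' (φ m), integral_map (hYm _) g.continuous.aestronglyMeasurable]
  -- the subsequential limit is chord-supported (stmt-4982), hence `P' F = 0`
  have hP'S : ∀ᵐ γ ∂P', (Q.chord 0 2 (by decide)).IsSimpleChord γ := by
    refine h1 (Q.chord 0 2 (by decide)) a b hab (fun m => δs (ns (φ m + N))) P'
      (hs'.comp hφ.tendsto_atTop) hP' fun g => ?_
    have h := hlim g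
    simp only [hint g] at h
    exact h
  have hPF : P' F = 0 := measure_mono_null (fun γ hγ => hF γ hγ) (ae_iff.1 hP'S)
  -- portmanteau for the closed set `F`
  let μs : ℕ → ProbabilityMeasure (CurveClass ℂ) := fun m => ⟨ν (δs (ns (φ m + N))), hνprob _⟩
  let Q' : ProbabilityMeasure (CurveClass ℂ) := ⟨P', hP'⟩
  have hTpm : Tendsto μs atTop (𝓝 Q') :=
    ProbabilityMeasure.tendsto_iff_forall_integral_tendsto.2 fun g => hlim g
  have hlimsup : limsup (fun m => (μs m : Measure (CurveClass ℂ)) F) atTop ≤ 0 := by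
    have h := ProbabilityMeasure.limsup_measure_closed_le_of_tendsto hTpm hFc
    have hQ : (Q' : Measure (CurveClass ℂ)) F = 0 := hPF
    rwa [hQ] at h
  have h0 : Tendsto (fun m => (μs m : Measure (CurveClass ℂ)) F) atTop (𝓝 0) :=
    tendsto_of_le_liminf_of_limsup_le bot_le hlimsup
  refine ⟨fun m => φ m + N, h0.congr fun m => ?_⟩
  show ν (δs (ns (φ m + N))) F = _
  rw [hN' (φ m), Measure.map_apply (SAW.DomainSAW.measurable_of_top _) hFc.measurableSet]
  rfl

/-- **Simple chords exist** in every conformal rectangle carrying an endpoint approximation, under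
`EventualTight` and `SimpleSubseqLimits`: otherwise `tendsto_measure_curve_mem_of_isClosed` with
`F = univ` makes the total SAW mass vanish along `δₙ = 1/(n+1)`, while the laws are probability
measures for all small `δ`. [folklore] -/
theorem nonempty_isSimpleChord_of_eventualTight_of_simpleSubseqLimits
    (hT : SAWWeldingIdentification.EventualTight) (h1 : SAWLoopFugacityFlow.SimpleSubseqLimits)
    (Q : ConformalRectangle) (a b : ℝ → Site 2)
    (hab : SAW.IsEndpointApprox (Q.chord 0 2 (by decide)) a b) :
    {γ : CurveClass ℂ | (Q.chord 0 2 (by decide)).IsSimpleChord γ}.Nonempty := by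
  by_contra hS
  rw [Set.not_nonempty_iff_eq_empty] at hS
  have hnone : ∀ γ ∈ (univ : Set (CurveClass ℂ)), ¬ (Q.chord 0 2 (by decide)).IsSimpleChord γ := by
    intro γ _ hγ
    have : γ ∈ ({γ : CurveClass ℂ | (Q.chord 0 2 (by decide)).IsSimpleChord γ} : Set _) := hγ
    rw [hS] at this
    exact this
  -- the mesh sequence `1/(n+1)`
  set δs : ℕ → ℝ := fun n => 1 / ((n : ℝ) + 1) with hδs
  have hpos : ∀ n, 0 < δs n := fun n => Nat.one_div_pos_of_nat
  have hδ : Tendsto δs atTop (𝓝 0) := tendsto_one_div_add_atTop_nhds_zero_nat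
  have h0 := tendsto_measure_curve_mem_of_isClosed hT h1 Q a b hab δs hpos hδ isClosed_univ hnone
  -- but the laws are eventually probability measures: total mass `1`
  have hPδ : ∀ᶠ δ in 𝓝[>] (0 : ℝ), IsProbabilityMeasure (SAW.law Q.carrier δ (a δ) (b δ)) :=
    (SubseqIdentification.Negative.eventually_isProbabilityMeasure_law hab).mono
      fun δ h => ⟨h.measure_univ⟩
  have hP : ∀ᶠ n in atTop, IsProbabilityMeasure
      (SAW.law Q.carrier (δs n) (a (δs n)) (b (δs n))) :=
    (tendsto_nhdsWithin_Ioi_of_pos hpos hδ).eventually hPδ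
  have h1' : ∀ᶠ n in atTop, SAW.law Q.carrier (δs n) (a (δs n)) (b (δs n))
      {ω | ω.curve ∈ (univ : Set (CurveClass ℂ))} = 1 := by
    filter_upwards [hP] with n hn
    haveI := hn
    simp
  have h01 : Tendsto (fun n => SAW.law Q.carrier (δs n) (a (δs n)) (b (δs n))
      {ω | ω.curve ∈ (univ : Set (CurveClass ℂ))}) atTop (𝓝 1) :=
    tendsto_const_nhds.congr' (h1'.mono fun n hn => hn.symm)
  exact zero_ne_one (tendsto_nhds_unique h0 h01)

/-! ### Chord proxies -/

/-- **Chord proxies exist under `EventualTight` ∧ `SimpleSubseqLimits`.** For every conformal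
rectangle `Q`, endpoint approximation of `(Ω; a, b) = Q.chord 0 2` and positive `δₙ → 0` there are
functions `cₙ` of the walk with values in the simple chords of `(Ω; a, b)` (for every `n` and every
walk) such that `P_δₙ {ε < dist ω.curve (cₙ ω)} → 0` for every `ε > 0`: choose `cₙ ω` among the
chords at distance `< infDist ω.curve {chords} + δₙ` (`Metric.infDist_lt_iff`, chords exist by
`nonempty_isSimpleChord_of_eventualTight_of_simpleSubseqLimits`); then for `δₙ ≤ ε/2` the event
`{ε < dist ω.curve (cₙ ω)}` lies in `{ω.curve ∈ F}` for the closed chord-free set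
`F = {γ | ε/2 ≤ infDist γ {chords}}`, whose mass vanishes
(`tendsto_measure_curve_mem_of_isClosed`). This is the geometric input of
`latticeWeldingLaw_of_sawScalingLimit` / `sawScalingLimit_iff_latticeWeldingLaw`, discharged from
the route's own cruxes stmt-1372 and stmt-4982. [folklore] -/
theorem chordProxies_of_eventualTight_of_simpleSubseqLimits
    (hT : SAWWeldingIdentification.EventualTight) (h1 : SAWLoopFugacityFlow.SimpleSubseqLimits) :
    ∀ (Q : ConformalRectangle) (a b : ℝ → Site 2),
      SAW.IsEndpointApprox (Q.chord 0 2 (by decide)) a b →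
      ∀ (δs : ℕ → ℝ), (∀ n, 0 < δs n) → Tendsto δs atTop (𝓝 0) →
      ∃ c : (n : ℕ) → SAW.DomainSAW Q.carrier (δs n) (a (δs n)) (b (δs n)) → CurveClass ℂ,
        (∀ᶠ n in atTop, ∀ᵐ ω ∂(SAW.law Q.carrier (δs n) (a (δs n)) (b (δs n))),
          (Q.chord 0 2 (by decide)).IsSimpleChord (c n ω)) ∧
        (∀ ε : ℝ, 0 < ε →
          Tendsto (fun n => (SAW.law Q.carrier (δs n) (a (δs n)) (b (δs n))).real
            {ω | ε < dist ω.curve (c n ω)}) atTop (𝓝 0)) := by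
  intro Q a b hab δs hpos hδ
  set S : Set (CurveClass ℂ) := {γ | (Q.chord 0 2 (by decide)).IsSimpleChord γ} with hSdef
  have hSne : S.Nonempty :=
    nonempty_isSimpleChord_of_eventualTight_of_simpleSubseqLimits hT h1 Q a b hab
  -- nearest-chord selection up to `δₙ`
  have hsel : ∀ (n : ℕ) (ω : SAW.DomainSAW Q.carrier (δs n) (a (δs n)) (b (δs n))),
      ∃ γ ∈ S, dist ω.curve γ < Metric.infDist ω.curve S + δs n := fun n ω =>
    (Metric.infDist_lt_iff hSne).1 (lt_add_of_pos_right _ (hpos n))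
  choose c hcS hcd using hsel
  refine ⟨c, Eventually.of_forall fun n => ae_of_all _ fun ω => hcS n ω, fun ε hε => ?_⟩
  -- the closed chord-free set `F = {ε/2 ≤ infDist · S}`
  have hFc : IsClosed {γ : CurveClass ℂ | ε / 2 ≤ Metric.infDist γ S} :=
    isClosed_le continuous_const (Metric.continuous_infDist_pt S)
  have hF : ∀ γ ∈ {γ : CurveClass ℂ | ε / 2 ≤ Metric.infDist γ S},
      ¬ (Q.chord 0 2 (by decide)).IsSimpleChord γ := by
    intro γ hγ hγS
    have h0 : Metric.infDist γ S = 0 := Metric.infDist_zero_of_mem (by exact hγS)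
    have : ε / 2 ≤ 0 := by simpa [h0] using hγ
    linarith
  have hlim := tendsto_measure_curve_mem_of_isClosed hT h1 Q a b hab δs hpos hδ hFc hF
  -- pass to real masses and compare events for `δₙ ≤ ε/2`
  have hreal : Tendsto (fun n => (SAW.law Q.carrier (δs n) (a (δs n)) (b (δs n))).real
      {ω | ω.curve ∈ {γ : CurveClass ℂ | ε / 2 ≤ Metric.infDist γ S}}) atTop (𝓝 0) := by
    have h := (ENNReal.tendsto_toReal ENNReal.zero_ne_top).comp hlim
    rwa [ENNReal.toReal_zero] at h
  have hsmall : ∀ᶠ n in atTop, δs n ≤ ε / 2 := hδ.eventually (ge_mem_nhds (by positivity))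
  have hPδ : ∀ᶠ δ in 𝓝[>] (0 : ℝ), IsProbabilityMeasure (SAW.law Q.carrier δ (a δ) (b δ)) :=
    (SubseqIdentification.Negative.eventually_isProbabilityMeasure_law hab).mono
      fun δ h => ⟨h.measure_univ⟩
  have hP : ∀ᶠ n in atTop, IsProbabilityMeasure
      (SAW.law Q.carrier (δs n) (a (δs n)) (b (δs n))) :=
    (tendsto_nhdsWithin_Ioi_of_pos hpos hδ).eventually hPδ
  refine squeeze_zero' (Eventually.of_forall fun n => measureReal_nonneg) ?_ hreal
  filter_upwards [hsmall, hP] with n hn hPn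
  haveI := hPn
  refine measureReal_mono (fun ω (hω : ε < dist ω.curve (c n ω)) => ?_)
  show ε / 2 ≤ Metric.infDist ω.curve S
  have := hcd n ω
  linarith

/-! ### The sandwich, with the geometric input discharged -/

/-- **Modulo stmt-4982 and stmt-1372 alone, `SAWScalingLimit ⟺ lattice welding law`**: the chord
proxies of `sawScalingLimit_iff_latticeWeldingLaw` exist by
`chordProxies_of_eventualTight_of_simpleSubseqLimits`. [folklore] -/
theorem sawScalingLimit_iff_latticeWeldingLaw_of_eventualTight :
    SAWLoopFugacityFlow.SimpleSubseqLimits → SAWWeldingIdentification.EventualTight →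
    (_root_.SAWScalingLimit ↔
    (∀ (Q : ConformalRectangle) (a b : ℝ → Site 2),
      SAW.IsEndpointApprox (Q.chord 0 2 (by decide)) a b →
      ∀ (δs : ℕ → ℝ), (∀ n, 0 < δs n) → Tendsto δs atTop (𝓝 0) →
      ∃ c : (n : ℕ) → SAW.DomainSAW Q.carrier (δs n) (a (δs n)) (b (δs n)) → CurveClass ℂ,
        (∀ᶠ n in atTop, ∀ᵐ ω ∂(SAW.law Q.carrier (δs n) (a (δs n)) (b (δs n))),
          (Q.chord 0 2 (by decide)).IsSimpleChord (c n ω)) ∧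
        (∀ ε : ℝ, 0 < ε →
          Tendsto (fun n => (SAW.law Q.carrier (δs n) (a (δs n)) (b (δs n))).real
            {ω | ε < dist ω.curve (c n ω)}) atTop (𝓝 0)) ∧
        ∀ Γ : (NNReal → ℝ) → CurveClass ℂ,
          IsSLECurve ((8 : NNReal) / 3) (Q.chord 0 2 (by decide)) Γ →
          ∀ (k : ℕ) (x : Fin k → ℝ), (∀ i, 0 < x i) →
          ∀ g : BoundedContinuousFunction (Fin k → ℝ) ℝ,
            Tendsto (fun n => ∫ ω, g (fun i => conformalWelding Q (c n ω) (x i))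
                ∂(SAW.law Q.carrier (δs n) (a (δs n)) (b (δs n)))) atTop
              (𝓝 (∫ γ, g (fun i => conformalWelding Q γ (x i)) ∂(preWienerMeasure.map Γ))))) :=
  fun h1 hT =>
    sawScalingLimit_iff_latticeWeldingLaw h1 hT (chordProxies_of_eventualTight_of_simpleSubseqLimits hT h1)

/-- **The held stub 2a is EQUIVALENT to its lattice form, given the route's other cruxes.** Under
stmt-4982 (`SimpleSubseqLimits`) and stmt-1372 (`EventualTight`): `ApproxWeldingLaw ⟺ lattice
welding law`. (⇐) is `approxWeldingLaw_of_latticeWeldingLaw` (no hypothesis needed); (⇒): stub 2a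
with stmt-4982 and stmt-1372 gives the conjunct
(`sawScalingLimit_of_simpleSubseqLimits_of_approxWeldingLaw_of_eventualTight`), which with the
chord proxies of `chordProxies_of_eventualTight_of_simpleSubseqLimits` gives the lattice law
(`latticeWeldingLaw_of_sawScalingLimit`). So the reduction to the lattice adds no strength on this
route. [folklore] -/
theorem approxWeldingLaw_iff_latticeWeldingLaw (h1 : SAWLoopFugacityFlow.SimpleSubseqLimits)
    (hT : SAWWeldingIdentification.EventualTight) :
    (∀ (Q : ConformalRectangle) (a b : ℝ → Site 2),
      SAW.IsEndpointApprox (Q.chord 0 2 (by decide)) a b →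
      ∀ (P : Measure (CurveClass ℂ)), IsProbabilityMeasure P →
      ∀ (δs : ℕ → ℝ), (∀ n, 0 < δs n) → Tendsto δs atTop (𝓝 0) →
      (∀ f : BoundedContinuousFunction (CurveClass ℂ) ℝ,
        Tendsto (fun n => ∫ γ, f γ.curve ∂(SAW.law Q.carrier (δs n) (a (δs n)) (b (δs n))))
          atTop (𝓝 (∫ γ, f γ ∂P))) →
      (∀ᵐ γ ∂P, (Q.chord 0 2 (by decide)).IsSimpleChord γ) →
      ∃ Ps : ℕ → Measure (CurveClass ℂ),
        (∀ n, IsProbabilityMeasure (Ps n)) ∧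
        (∀ n, ∀ᵐ γ ∂(Ps n), (Q.chord 0 2 (by decide)).IsSimpleChord γ) ∧
        (∀ f : BoundedContinuousFunction (CurveClass ℂ) ℝ,
          Tendsto (fun n => ∫ γ, f γ ∂(Ps n)) atTop (𝓝 (∫ γ, f γ ∂P))) ∧
        ∀ Γ : (NNReal → ℝ) → CurveClass ℂ,
          IsSLECurve ((8 : NNReal) / 3) (Q.chord 0 2 (by decide)) Γ →
          ∀ (k : ℕ) (x : Fin k → ℝ), (∀ i, 0 < x i) →
          ∀ g : BoundedContinuousFunction (Fin k → ℝ) ℝ,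
            Tendsto (fun n => ∫ γ, g (fun i => conformalWelding Q γ (x i)) ∂(Ps n)) atTop
              (𝓝 (∫ γ, g (fun i => conformalWelding Q γ (x i)) ∂(preWienerMeasure.map Γ)))) ↔
    (∀ (Q : ConformalRectangle) (a b : ℝ → Site 2),
      SAW.IsEndpointApprox (Q.chord 0 2 (by decide)) a b →
      ∀ (δs : ℕ → ℝ), (∀ n, 0 < δs n) → Tendsto δs atTop (𝓝 0) →
      ∃ c : (n : ℕ) → SAW.DomainSAW Q.carrier (δs n) (a (δs n)) (b (δs n)) → CurveClass ℂ,
        (∀ᶠ n in atTop, ∀ᵐ ω ∂(SAW.law Q.carrier (δs n) (a (δs n)) (b (δs n))),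
          (Q.chord 0 2 (by decide)).IsSimpleChord (c n ω)) ∧
        (∀ ε : ℝ, 0 < ε →
          Tendsto (fun n => (SAW.law Q.carrier (δs n) (a (δs n)) (b (δs n))).real
            {ω | ε < dist ω.curve (c n ω)}) atTop (𝓝 0)) ∧
        ∀ Γ : (NNReal → ℝ) → CurveClass ℂ,
          IsSLECurve ((8 : NNReal) / 3) (Q.chord 0 2 (by decide)) Γ →
          ∀ (k : ℕ) (x : Fin k → ℝ), (∀ i, 0 < x i) →
          ∀ g : BoundedContinuousFunction (Fin k → ℝ) ℝ,
            Tendsto (fun n => ∫ ω, g (fun i => conformalWelding Q (c n ω) (x i))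
                ∂(SAW.law Q.carrier (δs n) (a (δs n)) (b (δs n)))) atTop
              (𝓝 (∫ γ, g (fun i => conformalWelding Q γ (x i)) ∂(preWienerMeasure.map Γ)))) :=
  ⟨fun hA => latticeWeldingLaw_of_sawScalingLimit
      (sawScalingLimit_of_simpleSubseqLimits_of_approxWeldingLaw_of_eventualTight h1 hA hT)
      (chordProxies_of_eventualTight_of_simpleSubseqLimits hT h1),
    fun hL => approxWeldingLaw_of_latticeWeldingLaw hL⟩

end Summit.CriticalPhenomena.SAWScalingLimit.Theorems.WeldingLawOfLimit

end
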